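import Literature.NumberTheory.EllipticCurves.IwasawaAlgebraSpecializationLambdaProofs
import Literature.NumberTheory.EllipticCurves.PadicIntLatticeIndexProofs
import Literature.NumberTheory.EllipticCurves.PadicNormValuesProofs
import Summits.BirchSwinnertonDyer.BirchSwinnertonDyer.Theorems.CumulativeHeegnerLeopoldtCumulativeHeegnerInclusionAtThreeUnrSeriesTadicPin
import Summits.BirchSwinnertonDyer.BirchSwinnertonDyer.Theorems.CumulativeHeegnerLeopoldtCumulativeHeegnerInclusionAtThreeUnrSeriesZeros
import Summits.BirchSwinnertonDyer.Rank1Residual.Iwasawa.SelmerCardOfLevelZeroControlLambda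
import HarnessLib

/-!
# Crux K1 `CumulativeHeegnerInclusionAtThree` (stmt-BirchSwinnertonDyer-24198), line `birth`, stub A (= crux 26896):
# THE VALUES LINK `#(Λ ⧸ (Q, g)) · ‖g(x)‖^{deg Q} = 1` between the index-currency specialisation principle and
# the values-currency adapters

Lead seat bsd-line-chl-k1-p1 g5 (`--supports stmt-BirchSwinnertonDyer-24198`). A Kolyvagin-system argument for
stub A / crux 26896 (step (d♮) of the tempered line, memo TEMPERED-LINE-VIABILITY-g4 §2) delivers, at each height-one
prime `(Q)` of `Λ = ℤ_p⟦T⟧` (`Q` distinguished irreducible), a bound on the SPECIALISED INDEX `#(X ⧸ Q X)` of the Selmer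
module; the Literature files `IwasawaAlgebraSpecializationCoprimeProofs` (p628183: `#(X ⧸ Q X) ≍ #(Λ ⧸ (Q, char X))`),
`PadicIntLatticeIndexProofs` (p629845: `#(S ⧸ sS) = ‖N_{S/ℤ_p}(s)‖⁻¹`) and `PadicNormValuesProofs` (`‖N(z)‖ = ‖ι z‖^{[K:ℚ_p]}`,
base change of the norm of `ℤ_p[X]/(Q)`) are assembled here with the Weierstrass isomorphism `Λ/(Q) ≅ ℤ_p[X]/(Q)` and the
analytic values `UnrSeries.HasValueAt` of the adapters (-w2: p622143, p622618; g4: p624927) into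

* `card_quotient_mul_norm_value_pow_eq_one` — **`#(Λ ⧸ (Q, g)) · ‖v‖ ^ deg Q = 1`** for `Q ∈ ℤ_p[T]` distinguished
  irreducible, `g ∈ Λ` relatively prime to `Q`, `x ∈ ℚ̄_p` a root of `Q` and `v = g(x)` the value of `g ↦ R₀⟦T⟧` at `x`
  (so `#(Λ ⧸ (Q, g)) = |N_{ℚ_p(x)/ℚ_p}(g(x))|_p^{-1} = ‖g(x)‖^{-deg Q}`);
* helper values lemmas `norm_coe_lt_one_of_aeval_eq_zero` (roots of distinguished polynomials lie in the open disc),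
  `hasValueAt_map_toUnr_coe` (a polynomial `r ∈ ℤ_p[T]` has value `r(x)`), `value_eq_eval_of_sub_mem`
  (`g ≡ r (mod Q)` ⟹ `g(x) = r(x)`); and §3 `exists_C_pow_mul_mem_span_of_card_quotSMulTop_le` — **a Kolyvagin-system
  bound in INDEX currency at the algebraic specialisations ⟹ stub A's divisibility `p^μ · L ∈ (g)`**.

HONEST FRAMING: pure algebra/analysis on `Λ`, `ℚ̄_p`, `ℂ_p`; no Selmer group, class or `L`-function is touched; stub A
and K1 stay open (K1 = A + print); BSD is not proved by any of this.
-/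

set_option linter.dupNamespace false
set_option autoImplicit false

noncomputable section

open scoped Classical Polynomial
open Literature.NumberTheory.EllipticCurves Literature.NumberTheory.EllipticCurves.IwasawaAlgebra
  Summit.BirchSwinnertonDyer.Rank1Residual.X11b.Halves
  Summit.BirchSwinnertonDyer.BirchSwinnertonDyer.Theorems.CumulativeHeegnerInclusionAtThreeUnrSeriesDomination
  Summit.BirchSwinnertonDyer.BirchSwinnertonDyer.Theorems.CumulativeHeegnerInclusionAtThreeUnrSeriesZeros
  Summit.BirchSwinnertonDyer.BirchSwinnertonDyer.Theorems.CongruentShaFreeCutBDPUpToPowerMapIdentity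

namespace Summit.BirchSwinnertonDyer.BirchSwinnertonDyer.Theorems.CumulativeHeegnerInclusionAtThreeSpecialisationValues

variable {p : ℕ} [Fact p.Prime]

/-! ### §1 Values of polynomials of `ℤ_p[T]` at points of `ℚ̄_p ⊂ ℂ_p` -/

/-- The structure map `ℤ_p → ℂ_p` (through `ℚ_p`); it is `R₀ ↪ ℂ_p ∘ toUnr`. -/
theorem subtype_comp_toUnr :
    (unrIntegers p).subtype.comp (toUnr p) = (algebraMap ℚ_[p] ℂ_[p]).comp (algebraMap ℤ_[p] ℚ_[p]) := by
  ext x; rfl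

/-- **Roots of a distinguished polynomial lie in the open unit disc**: if `Q ∈ ℤ_p[T]` is distinguished of
positive degree and `x ∈ ℚ̄_p` is a root of `Q`, then `‖x‖ < 1` (in `ℂ_p`). -/
theorem norm_coe_lt_one_of_aeval_eq_zero {Q : ℤ_[p][X]}
    (hQ : Q.IsDistinguishedAt (IsLocalRing.maximalIdeal ℤ_[p]))
    {x : PadicAlgCl p} (hx : Polynomial.aeval x (Q.map (algebraMap ℤ_[p] ℚ_[p])) = 0) :
    ‖(x : ℂ_[p])‖ < 1 := by
  set φ₂ : ℤ_[p] →+* ℂ_[p] := (algebraMap ℚ_[p] ℂ_[p]).comp (algebraMap ℤ_[p] ℚ_[p]) with hφ₂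
  have hmo : (Q.map φ₂).Monic := hQ.monic.map φ₂
  refine norm_root_lt_one hmo (fun k hk => ?_) ?_
  · have hk' : k < Q.natDegree := by
      have hnat := Polynomial.Monic.natDegree_map hQ.monic φ₂
      omega
    have hmem := hQ.mem hk'
    rw [IsLocalRing.mem_maximalIdeal, PadicInt.mem_nonunits, PadicInt.norm_def] at hmem
    rw [Polynomial.coeff_map, hφ₂, RingHom.comp_apply, IsScalarTower.algebraMap_apply ℚ_[p] (PadicAlgCl p) ℂ_[p],
      ← PadicComplex.coe_eq, PadicComplex.norm_extends', PadicInt.algebraMap_apply]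
    exact hmem
  · -- `Q(x) = 0` in `ℂ_p`
    rw [Polynomial.IsRoot.def, Polynomial.eval_map, hφ₂, ← Polynomial.eval₂_map,
      ← Polynomial.aeval_def, PadicComplex.coe_eq,
      show algebraMap (PadicAlgCl p) ℂ_[p] x = IsScalarTower.toAlgHom ℚ_[p] (PadicAlgCl p) ℂ_[p] x from rfl,
      Polynomial.aeval_algHom_apply, hx, map_zero]

/-- **A polynomial `r ∈ ℤ_p[T]`, pushed to `R₀⟦T⟧`, has value `r(y)` at every `y ∈ ℂ_p`.** -/
theorem hasValueAt_map_toUnr_coe (r : ℤ_[p][X]) (y : ℂ_[p]) :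
    UnrSeries.HasValueAt (PowerSeries.map (toUnr p) (r : IwasawaAlgebra p)) y
      ((r.map ((algebraMap ℚ_[p] ℂ_[p]).comp (algebraMap ℤ_[p] ℚ_[p]))).eval y) := by
  have h := hasValueAt_coe_polynomial (r.map (toUnr p)) y
  rw [Polynomial.map_map, subtype_comp_toUnr, Polynomial.polynomial_map_coe] at h
  exact h

/-- **`g ≡ r (mod Q)` ⟹ `g(x) = r(x)`** at a root `x ∈ ℚ̄_p` of the distinguished `Q`: if `g - r ∈ (Q)·Λ` for a
polynomial `r`, then any value `v` of `g ↦ R₀⟦T⟧` at `x` is `r(x)` (the value of `Q` at its root is `0`). -/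
theorem value_eq_eval_of_sub_mem {Q : ℤ_[p][X]}
    (hQ : Q.IsDistinguishedAt (IsLocalRing.maximalIdeal ℤ_[p]))
    {x : PadicAlgCl p} (hx : Polynomial.aeval x (Q.map (algebraMap ℤ_[p] ℚ_[p])) = 0)
    {g : IwasawaAlgebra p} {r : ℤ_[p][X]}
    (hgr : g - (r : IwasawaAlgebra p) ∈ Ideal.span {(Q : IwasawaAlgebra p)}) {v : ℂ_[p]}
    (hv : UnrSeries.HasValueAt (PowerSeries.map (toUnr p) g) (x : ℂ_[p]) v) :
    v = (r.map ((algebraMap ℚ_[p] ℂ_[p]).comp (algebraMap ℤ_[p] ℚ_[p]))).eval (x : ℂ_[p]) := by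
  set φ₂ : ℤ_[p] →+* ℂ_[p] := (algebraMap ℚ_[p] ℂ_[p]).comp (algebraMap ℤ_[p] ℚ_[p]) with hφ₂
  have hx1 : ‖(x : ℂ_[p])‖ < 1 := norm_coe_lt_one_of_aeval_eq_zero hQ hx
  obtain ⟨h, hh⟩ := Ideal.mem_span_singleton'.mp hgr
  -- `g = r + h * Q`
  have hg : g = (r : IwasawaAlgebra p) + h * (Q : IwasawaAlgebra p) := by rw [hh]; ring
  -- values: `r(x)`, `h(x) = w`, `Q(x) = 0`
  have hr := hasValueAt_map_toUnr_coe r (x : ℂ_[p])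
  obtain ⟨w, hw⟩ := exists_hasValueAt (PowerSeries.map (toUnr p) h) hx1
  have hQ0 : (Q.map φ₂).eval (x : ℂ_[p]) = 0 := by
    rw [Polynomial.eval_map, hφ₂, ← Polynomial.eval₂_map, ← Polynomial.aeval_def, PadicComplex.coe_eq,
      show algebraMap (PadicAlgCl p) ℂ_[p] x = IsScalarTower.toAlgHom ℚ_[p] (PadicAlgCl p) ℂ_[p] x from rfl,
      Polynomial.aeval_algHom_apply, hx, map_zero]
  have hQv := hasValueAt_map_toUnr_coe Q (x : ℂ_[p])
  rw [hQ0] at hQv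
  have hprod : UnrSeries.HasValueAt (PowerSeries.map (toUnr p) (h * (Q : IwasawaAlgebra p))) (x : ℂ_[p]) (w * 0) := by
    rw [map_mul]; exact hasValueAt_mul hx1 hw hQv
  have hsum : UnrSeries.HasValueAt (PowerSeries.map (toUnr p) g) (x : ℂ_[p])
      ((r.map φ₂).eval (x : ℂ_[p]) + w * 0) := by
    rw [hg, map_add]; exact hasValueAt_add hr hprod
  rw [mul_zero, add_zero] at hsum
  exact hv.unique hsum

/-! ### §2 The values link -/

/-- **THE VALUES LINK.** Let `Q ∈ ℤ_p[T]` be distinguished irreducible of degree `d`, `g ∈ Λ = ℤ_p⟦T⟧` relatively prime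
to `Q`, `x ∈ ℚ̄_p` a root of `Q` and `v` the value at `x` of `g` pushed to `R₀⟦T⟧`. Then
`#(Λ ⧸ (Q, g)) · ‖v‖ ^ d = 1`, i.e. `#(Λ ⧸ (Q, g)) = |N_{ℚ_p(x)/ℚ_p}(g(x))|_p⁻¹ = ‖g(x)‖^{-d}`. Proof: Weierstrass
`Λ/(Q) ≅ ℤ_p[T]/(Q) = S` carries `ḡ` to some `r̄`, `#(S ⧸ r̄S) = ‖N_{S/ℤ_p}(r̄)‖⁻¹` (Smith normal form over `ℤ_p`),
`N_{S/ℤ_p}(r̄) = N_{ℚ_p(x)/ℚ_p}(r(x))` (base change), `‖N(r(x))‖ = ‖r(x)‖^d` (spectral norm on `ℚ̄_p`), and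
`g(x) = r(x)` since `g ≡ r (mod Q)`. This is how a Kolyvagin-system bound delivered at the height-one prime `(Q)` in
INDEX currency is read in the VALUES currency of the adapters p622143 / p622618 / p624927. -/
theorem card_quotient_mul_norm_value_pow_eq_one {Q : ℤ_[p][X]}
    (hQ : Q.IsDistinguishedAt (IsLocalRing.maximalIdeal ℤ_[p])) (hirr : Irreducible Q)
    {g : IwasawaAlgebra p} (hcop : IsRelPrime g (Q : IwasawaAlgebra p))
    {x : PadicAlgCl p} (hx : Polynomial.aeval x (Q.map (algebraMap ℤ_[p] ℚ_[p])) = 0) {v : ℂ_[p]}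
    (hv : UnrSeries.HasValueAt (PowerSeries.map (toUnr p) g) (x : ℂ_[p]) v) :
    (Nat.card (IwasawaAlgebra p ⧸ (Ideal.span {(Q : IwasawaAlgebra p)} ⊔ Ideal.span {g})) : ℝ) *
      ‖v‖ ^ Q.natDegree = 1 := by
  have hp : p.Prime := Fact.out
  have hd : 0 < Q.natDegree := natDegree_pos_of_irreducible p hQ hirr
  set φ := algebraMap ℤ_[p] ℚ_[p] with hφ
  have hQm : Q.Monic := hQ.monic
  have hQ' : (Q.map φ).Monic := hQm.map φ
  -- `Q` is irreducible over `ℚ_p` (Gauss), so `K = ℚ_p[X]/(Q)` is a field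
  have hirr' : Irreducible (Q.map φ) := (hQm.irreducible_iff_irreducible_map_fraction_map).mp hirr
  haveI : Fact (Irreducible (Q.map φ)) := ⟨hirr'⟩
  haveI : Module.Finite ℚ_[p] (AdjoinRoot (Q.map φ)) := hQ'.finite_adjoinRoot
  haveI : Module.Free ℤ_[p] (AdjoinRoot Q) := hQm.free_adjoinRoot
  haveI : Module.Finite ℤ_[p] (AdjoinRoot Q) := hQm.finite_adjoinRoot
  haveI : IsDomain (AdjoinRoot Q) :=
    AdjoinRoot.isDomain_of_prime (UniqueFactorizationMonoid.irreducible_iff_prime.mp hirr)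
  -- the Weierstrass isomorphism `e : S = ℤ_p[X]/(Q) ≃ Λ/(Q)` and the element `s = e⁻¹(ḡ)`
  let e : AdjoinRoot Q ≃ₐ[ℤ_[p]] (IwasawaAlgebra p ⧸ Ideal.span {(Q : IwasawaAlgebra p)}) :=
    hQ.algEquivQuotient
  have he : ∀ r : ℤ_[p][X], e (AdjoinRoot.mk Q r) = Ideal.Quotient.mk _ (r : IwasawaAlgebra p) :=
    fun r => rfl
  set s : AdjoinRoot Q := e.symm (Ideal.Quotient.mk _ g) with hsdef
  obtain ⟨r, hr⟩ := AdjoinRoot.mk_surjective s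
  -- `g ≡ r (mod Q)` in `Λ`
  have hgr : g - (r : IwasawaAlgebra p) ∈ Ideal.span {(Q : IwasawaAlgebra p)} := by
    rw [← Ideal.Quotient.eq, ← he r, hr, hsdef, AlgEquiv.apply_symm_apply]
  -- `s ≠ 0`: otherwise `Q ∣ g`, contradicting coprimality
  have hs0 : s ≠ 0 := by
    intro h0
    have h1 : (Ideal.Quotient.mk (Ideal.span {(Q : IwasawaAlgebra p)}) g) = 0 := by
      rw [← e.apply_symm_apply (Ideal.Quotient.mk _ g), ← hsdef, h0, map_zero]
    rw [Ideal.Quotient.eq_zero_iff_mem, Ideal.mem_span_singleton] at h1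
    exact Summit.BirchSwinnertonDyer.Rank1Residual.Iwasawa.not_isUnit_coe_of_isDistinguishedAt_of_natDegree_pos hQ hd
        (hcop h1 dvd_rfl)
  -- Step 1: `Λ/(Q, g) ≅ S/(s)`
  have hcard : Nat.card (IwasawaAlgebra p ⧸ (Ideal.span {(Q : IwasawaAlgebra p)} ⊔ Ideal.span {g})) =
      Nat.card (AdjoinRoot Q ⧸ Ideal.span {s}) := by
    have h1 : (Ideal.span {g}).map (Ideal.Quotient.mk (Ideal.span {(Q : IwasawaAlgebra p)})) =
        Ideal.span {Ideal.Quotient.mk (Ideal.span {(Q : IwasawaAlgebra p)}) g} := by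
      rw [Ideal.map_span, Set.image_singleton]
    have e3 : ((IwasawaAlgebra p ⧸ Ideal.span {(Q : IwasawaAlgebra p)}) ⧸
        Ideal.span {Ideal.Quotient.mk (Ideal.span {(Q : IwasawaAlgebra p)}) g}) ≃+*
          AdjoinRoot Q ⧸ Ideal.span {s} :=
      Ideal.quotientEquiv _ _ e.symm.toRingEquiv (by
        rw [Ideal.map_span, Set.image_singleton]
        rfl)
    exact (Nat.card_congr (DoubleQuot.quotQuotEquivQuotSup (Ideal.span {(Q : IwasawaAlgebra p)})
        (Ideal.span {g})).toEquiv).symm.trans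
      ((Nat.card_congr (Ideal.quotEquivOfEq h1).toEquiv).trans (Nat.card_congr e3.toEquiv))
  -- Step 2: `#(S/(s)) = ‖N(s)‖⁻¹`
  have hindex : (Nat.card (AdjoinRoot Q ⧸ Ideal.span {s}) : ℝ) = ‖Algebra.norm ℤ_[p] s‖⁻¹ :=
    PadicInt.card_quotient_span_singleton_eq_inv_norm_norm
      (fun y hy => (mul_eq_zero.mp hy).resolve_left hs0)
  -- Step 3: `‖N_{S/ℤ_p}(s)‖ = ‖r(x)‖ ^ d` through `K = ℚ_p[X]/(Q) ↪ ℚ̄_p`, `X ↦ x`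
  have hx' : (Q.map φ).eval₂ (↑(Algebra.ofId ℚ_[p] (PadicAlgCl p)) : ℚ_[p] →+* PadicAlgCl p) x = 0 := hx
  let ι : AdjoinRoot (Q.map φ) →ₐ[ℚ_[p]] PadicAlgCl p :=
    AdjoinRoot.liftAlgHom (Q.map φ) (Algebra.ofId ℚ_[p] (PadicAlgCl p)) x hx'
  have hι : ι (AdjoinRoot.mk (Q.map φ) (r.map φ)) = Polynomial.aeval x (r.map φ) :=
    AdjoinRoot.liftAlgHom_mk _ _ _ _ _
  have hnorm : ‖Algebra.norm ℤ_[p] s‖ = ‖(Polynomial.aeval x (r.map φ) : PadicAlgCl p)‖ ^ Q.natDegree := by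
    rw [← hr, PadicInt.norm_def,
      show ((Algebra.norm ℤ_[p] (AdjoinRoot.mk Q r) : ℤ_[p]) : ℚ_[p]) =
        algebraMap ℤ_[p] ℚ_[p] (Algebra.norm ℤ_[p] (AdjoinRoot.mk Q r)) from rfl,
      PadicInt.algebraMap_norm_adjoinRoot_mk hQm r, PadicAlgCl.norm_algebraNorm_eq_norm_pow_finrank ι, hι,
      (AdjoinRoot.powerBasis' hQ').finrank, AdjoinRoot.powerBasis'_dim, hQm.natDegree_map]
  -- Step 4: `v = r(x)`
  have hval : ‖v‖ = ‖(Polynomial.aeval x (r.map φ) : PadicAlgCl p)‖ := by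
    rw [value_eq_eval_of_sub_mem hQ hx hgr hv,
      ← PadicComplex.norm_extends (x := Polynomial.aeval x (r.map φ))]
    congr 1
    rw [PadicComplex.coe_eq (x := Polynomial.aeval x (r.map φ)),
      show algebraMap (PadicAlgCl p) ℂ_[p] (Polynomial.aeval x (r.map φ)) =
        IsScalarTower.toAlgHom ℚ_[p] (PadicAlgCl p) ℂ_[p] (Polynomial.aeval x (r.map φ)) from rfl,
      ← Polynomial.aeval_algHom_apply, Polynomial.aeval_def, Polynomial.eval₂_map, Polynomial.eval_map]
    rfl
  -- assemble
  have hN0 : Algebra.norm ℤ_[p] s ≠ 0 := Algebra.norm_ne_zero_iff.mpr hs0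
  rw [hcard, hindex, hval, ← hnorm, inv_mul_cancel₀ (norm_ne_zero_iff.mpr hN0)]


/-! ### §3 From an index-currency Kolyvagin-system bound at the algebraic specialisations to stub A's currency -/

/-- The push-forward `g ↦ R₀⟦T⟧` of a non-zero `g ∈ Λ` is non-zero (`ℤ_p → R₀ ⊂ ℂ_p` is injective). -/
theorem map_toUnr_ne_zero {g : IwasawaAlgebra p} (hg : g ≠ 0) : PowerSeries.map (toUnr p) g ≠ 0 := by
  intro h
  apply hg
  ext n
  have h1 := congrArg (fun F => ((PowerSeries.coeff n F : unrIntegers p) : ℂ_[p])) h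
  simp only [PowerSeries.coeff_map, coe_toUnr, map_zero, ZeroMemClass.coe_zero, map_eq_zero] at h1
  rw [map_zero]
  exact Subtype.ext h1

/-- **An algebraic point of the open unit disc is a root of a distinguished irreducible `Q ∈ ℤ_p[T]`**: for `y ∈ ℚ̄_p`
with `‖y‖ < 1` the minimal polynomial of `y` over `ℚ_p` has coefficients of norm `≤ 1` (its spectral value is `‖y‖`),
the non-leading ones of norm `< 1`, so it lifts to a distinguished (monic, irreducible) polynomial over `ℤ_p`. -/
theorem exists_isDistinguishedAt_irreducible_of_norm_lt_one {y : PadicAlgCl p} (hy : ‖y‖ < 1) :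
    ∃ Q : ℤ_[p][X], Q.IsDistinguishedAt (IsLocalRing.maximalIdeal ℤ_[p]) ∧ Irreducible Q ∧
      Polynomial.aeval y (Q.map (algebraMap ℤ_[p] ℚ_[p])) = 0 := by
  have hyi : IsIntegral ℚ_[p] y := Algebra.IsIntegral.isIntegral y
  set P := minpoly ℚ_[p] y with hP
  have hPm : P.Monic := minpoly.monic hyi
  have hspec : spectralValue P = ‖y‖ := rfl
  -- every coefficient has norm `≤ 1`
  have hle : ∀ n, ‖P.coeff n‖ ≤ 1 := (spectralValue_le_one_iff hPm).mp (hspec ▸ hy.le)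
  -- the non-leading coefficients have norm `< 1`
  have hlt : ∀ n < P.natDegree, ‖P.coeff n‖ < 1 := by
    intro n hn
    have h1 : spectralValueTerms P n ≤ ‖y‖ := hspec ▸ le_ciSup (spectralValueTerms_bddAbove P) n
    rw [spectralValueTerms_of_lt_natDegree P hn] at h1
    by_contra hge
    rw [not_lt] at hge
    have h2 : (1 : ℝ) ≤ ‖P.coeff n‖ ^ (1 / (P.natDegree - n : ℝ)) :=
      Real.one_le_rpow hge (by
        have : (n : ℝ) < P.natDegree := by exact_mod_cast hn
        exact div_nonneg zero_le_one (by linarith))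
    linarith
  -- lift to `ℤ_p[T]`
  have hlifts : P ∈ Polynomial.lifts (algebraMap ℤ_[p] ℚ_[p]) := by
    rw [Polynomial.lifts_iff_coeff_lifts]
    intro n
    exact ⟨⟨P.coeff n, hle n⟩, rfl⟩
  obtain ⟨Q, hQP, hQdeg, hQm⟩ := Polynomial.lifts_and_natDegree_eq_and_monic hlifts hPm
  refine ⟨Q, ⟨⟨fun {i} hi => ?_⟩, hQm⟩, ?_, ?_⟩
  · rw [IsLocalRing.mem_maximalIdeal, PadicInt.mem_nonunits, PadicInt.norm_def, ← PadicInt.algebraMap_apply,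
      ← Polynomial.coeff_map, hQP]
    exact hlt i (hQdeg ▸ hi)
  · exact Polynomial.Monic.irreducible_of_irreducible_map (φ := algebraMap ℤ_[p] ℚ_[p]) Q hQm
      (hQP ▸ minpoly.irreducible hyi)
  · rw [hQP]; exact minpoly.aeval ℚ_[p] y

/-- **From INDEX currency to stub A's currency.** Let `N` be a finitely generated torsion `Λ`-module with
`char N = (g₀)`, `g₀ ≠ 0`, and `L ∈ R₀⟦T⟧`. Suppose a Kolyvagin-system-type bound is available at every algebraic
specialisation in INDEX currency: for every distinguished irreducible `Q` prime to `g₀`, every root `y ∈ ℚ̄_p` of `Q` and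
the value `v = L(y)`, `#(N ⧸ Q N) · ‖v‖^{deg Q} ≤ p^{C · deg Q}` (i.e. `length ≤ ord L(y) + C` after normalising by the
degree). Then `p^μ · L ∈ (g₀ · R₀⟦T⟧)` for some `μ` — the divisibility of stub A / crux 26896 in the shape consumed by
`…UnrSeriesTadicPin` / `…TemperedDomination`. Proof: the index principle (`exists_card_quotSMulTop_bounds_of_isRelPrime`:
`#(Λ ⧸ (Q, g₀)) ≤ B · #(N ⧸ Q N)`), the values link (`#(Λ ⧸ (Q, g₀)) · ‖g₀(y)‖^{deg Q} = 1`) and the hypothesis give the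
domination `‖L(y)‖ ≤ B p^C · ‖g₀(y)‖` at every algebraic point off the finitely many zeros of `g₀`, whence the claim by
-w2's `exists_C_pow_mul_mem_span_of_norm_value_le_algebraic`. Nothing arithmetic is asserted: the HYPOTHESIS is what a
Kolyvagin-system argument for crux 26896 would have to deliver. -/
theorem exists_C_pow_mul_mem_span_of_card_quotSMulTop_le (N : Type*) [AddCommGroup N]
    [Module (IwasawaAlgebra p) N] [Module.Finite (IwasawaAlgebra p) N]
    (hN : Module.IsTorsion (IwasawaAlgebra p) N) {g₀ : IwasawaAlgebra p}
    (hg₀ : Module.charIdeal (IwasawaAlgebra p) N = Ideal.span {g₀}) (hg0 : g₀ ≠ 0)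
    {L : UnrSeries p} {C : ℕ}
    (hKS : ∀ Q : ℤ_[p][X], Q.IsDistinguishedAt (IsLocalRing.maximalIdeal ℤ_[p]) → Irreducible Q →
      IsRelPrime g₀ (Q : IwasawaAlgebra p) →
      ∀ y : PadicAlgCl p, Polynomial.aeval y (Q.map (algebraMap ℤ_[p] ℚ_[p])) = 0 →
      ∀ v : ℂ_[p], L.HasValueAt (y : ℂ_[p]) v →
        (Nat.card (N ⧸ (Ideal.span {(Q : IwasawaAlgebra p)} • ⊤ : Submodule (IwasawaAlgebra p) N)) : ℝ) *
          ‖v‖ ^ Q.natDegree ≤ (p : ℝ) ^ (C * Q.natDegree)) :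
    ∃ μ : ℕ, PowerSeries.C (((p : ℕ) : unrIntegers p) ^ μ) * L ∈
      Ideal.span {PowerSeries.map (toUnr p) g₀} := by
  have hp : p.Prime := Fact.out
  set g : UnrSeries p := PowerSeries.map (toUnr p) g₀ with hgdef
  have hg : g ≠ 0 := map_toUnr_ne_zero hg0
  -- the finitely many zeros of `g` in the open disc
  have hF : {z : ℂ_[p] | ‖z‖ < 1 ∧ g.HasValueAt z 0}.Finite := finite_zeros hg
  obtain ⟨B, hB, hbd⟩ := exists_card_quotSMulTop_bounds_of_isRelPrime p N hN
  refine Summit.BirchSwinnertonDyer.BirchSwinnertonDyer.Theorems.CumulativeHeegnerInclusionAtThreeUnrSeriesTadicPin.exists_C_pow_mul_mem_span_of_norm_value_le_algebraic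
    hg hF (C := (B : ℝ) * (p : ℝ) ^ C) ?_
  intro y hyF hy1 u v hu hv
  -- `y` is a root of a distinguished irreducible `Q`
  have hy1' : ‖y‖ < 1 := by rwa [PadicComplex.norm_extends] at hy1
  obtain ⟨Q, hQ, hirr, hyQ⟩ := exists_isDistinguishedAt_irreducible_of_norm_lt_one hy1'
  have hd : 0 < Q.natDegree := natDegree_pos_of_irreducible p hQ hirr
  -- `g₀(y) ≠ 0`, so `Q ∤ g₀` and `g₀` is prime to `Q`
  have hu0 : u ≠ 0 := by
    intro h0
    exact hyF ⟨hy1, h0 ▸ hu⟩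
  have hcop : IsRelPrime g₀ (Q : IwasawaAlgebra p) := by
    refine ((prime_coe_of_irreducible p hQ hirr).irreducible.isRelPrime_iff_not_dvd.mpr ?_).symm
    rintro ⟨k, hk⟩
    -- then `g₀ ≡ 0 (mod Q)` and `g₀(y) = 0`
    have hmem : g₀ - ((0 : ℤ_[p][X]) : IwasawaAlgebra p) ∈ Ideal.span {(Q : IwasawaAlgebra p)} := by
      rw [Polynomial.coe_zero, sub_zero, hk]
      exact Ideal.mul_mem_right _ _ (Ideal.mem_span_singleton_self _)
    have h0 := value_eq_eval_of_sub_mem hQ hyQ hmem hu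
    rw [Polynomial.map_zero, Polynomial.eval_zero] at h0
    exact hu0 h0
  -- the three inputs
  have hlink := card_quotient_mul_norm_value_pow_eq_one hQ hirr hcop hyQ hu
  obtain ⟨-, h1, -⟩ := hbd Q hQ g₀ hg₀ hcop
  rw [hg₀] at h1
  have h2 := hKS Q hQ hirr hcop y hyQ v hv
  -- combine: `‖v‖^d ≤ (B p^C ‖u‖)^d`
  set d := Q.natDegree with hddef
  set c₁ : ℝ := ((Nat.card (IwasawaAlgebra p ⧸ (Ideal.span {(Q : IwasawaAlgebra p)} ⊔ Ideal.span {g₀})) : ℕ) : ℝ)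
    with hc₁
  set c₂ : ℝ := ((Nat.card (N ⧸ (Ideal.span {(Q : IwasawaAlgebra p)} • ⊤ : Submodule (IwasawaAlgebra p) N)) : ℕ) : ℝ)
    with hc₂
  have h1' : c₁ ≤ B * c₂ := by rw [hc₁, hc₂]; exact_mod_cast h1
  have hB1 : (1 : ℝ) ≤ B := by exact_mod_cast hB
  have hu' : 0 ≤ ‖u‖ ^ d := pow_nonneg (norm_nonneg _) _
  have hv' : 0 ≤ ‖v‖ ^ d := pow_nonneg (norm_nonneg _) _
  have hc₂0 : 0 ≤ c₂ := by rw [hc₂]; exact Nat.cast_nonneg _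
  have hpow : ‖v‖ ^ d ≤ ((B : ℝ) * (p : ℝ) ^ C * ‖u‖) ^ d := by
    calc ‖v‖ ^ d = ‖v‖ ^ d * (c₁ * ‖u‖ ^ d) := by rw [hlink, mul_one]
      _ ≤ ‖v‖ ^ d * (B * c₂ * ‖u‖ ^ d) := by gcongr
      _ = B * (c₂ * ‖v‖ ^ d) * ‖u‖ ^ d := by ring
      _ ≤ B * (p : ℝ) ^ (C * d) * ‖u‖ ^ d := by gcongr
      _ ≤ (B : ℝ) ^ d * ((p : ℝ) ^ C) ^ d * ‖u‖ ^ d := by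
          rw [← pow_mul]
          gcongr
          exact le_self_pow₀ hB1 hd.ne'
      _ = ((B : ℝ) * (p : ℝ) ^ C * ‖u‖) ^ d := by ring
  exact (pow_le_pow_iff_left₀ (norm_nonneg _) (by positivity) hd.ne').mp hpow

end Summit.BirchSwinnertonDyer.BirchSwinnertonDyer.Theorems.CumulativeHeegnerInclusionAtThreeSpecialisationValues

end
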